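import Summits.BirchSwinnertonDyer.BirchSwinnertonDyer.Theorems.ManinLocalTwoThreeEtaLogDerivativeForms
import Summits.BirchSwinnertonDyer.BirchSwinnertonDyer.Theorems.ManinLocalTwoThreeEulerRemaindersSixtyFour
import Summits.BirchSwinnertonDyer.BirchSwinnertonDyer.Theorems.ManinLocalTwoThreeEulerRemaindersTwenty
import HarnessLib

/-!
# Level 72 = 2³·3², the `q`-toolkit I: the Euler functions `E₂, E₄, E₆, E₁₂` and `E₂(δτ)` (`δ ∣ 36`) to `o(q¹³)`

Cell bsd-f2-manin, route `ManinLocalTwoThree` (cruxes C2 `ManinOddAtFour` stmt-22967: `2² ∣ 72`, AND C3 `ManinPrimeToThreeAtNine`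
stmt-22968: `3² ∣ 72` — the first level of BOTH domains with `g(X₀(N)) > 1`, here `g = 5`), prover seat p3 gen 24.

RECONNAISSANCE (p2 g27 / p3 g23 `recon.py`, re-verified p3 g24 `work/g4/gen72.py`, exact `q`-series): the optimal curve
`72a1 = [0, 0, 0, 6, −7] : y² = x³ + 6x − 7` of `X₀(72)` has Weierstrass coordinates
`x = 1 + 𝓔`, `𝓔 = η₂η₄/(η₁₈η₃₆)` (a `Γ₀(36)`-INVARIANT function) and `y = η₆²η₁₂²/(η₁₈²η₃₆²)` (`y∘W₃₆ = −y`), newform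
`φ₇₂ = ⅔h₁ + ⅓h₂`, `h₁ = η₄⁴η₆²/η₂²`, `h₂ = η₂⁴η₁₂²/η₄²` (p2's fact-free pinning `NewformSeventyTwo.f_apply_eq_phi72`).
The "E₂ road" (`EtaLogDerivativeForms`): `𝓔′ = (πi/12)·G·𝓔`, `G = 2E₂(2τ) + 4E₂(4τ) − 18E₂(18τ) − 36E₂(36τ)`, so (I2a)
`x′ = −2πiφ₇₂·2y` ⟺ **`G + 32A + 16B = 0`** with the HOLOMORPHIC weight-`2` `η`-quotients `A = h₁y/𝓔`, `B = h₂y/𝓔` of level `36`;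
and `y′ = (πi/12)·G_y·y`, `G_y = 12E₂(6τ) + 24E₂(12τ) − 36E₂(18τ) − 72E₂(36τ)`, so (I2b) `y′ = −2πiφ₇₂(3x² + 6)` ⟺
**`G_y + 144C₁ + 72C₂ + 96C₃ + 48C₄ + 48C₅ + 24C₆ = 0`**, `C₁ = h₁/y, C₂ = h₂/y, C₃ = h₁𝓔/y, C₄ = h₂𝓔/y, C₅ = h₁𝓔²/y, C₆ = h₂𝓔²/y`
(all holomorphic of weight `2` on `Γ₀(36)`).  Both are identities in `M₂(Γ₀(36))` (Sturm: `13` coefficients).  This file supplies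
the `q`-expansions to `o(q¹³)` (`E_δ = ∏(1 − q^{δn}) = eulerFn δ`):

* §1 `E₂ = 1 − q² − q⁴ + q¹⁰`, `E₄ = 1 − q⁴ − q⁸`, `E₆ = 1 − q⁶ − q¹²`, `E₁₂ = 1 − q¹²` (`+ o(q¹³)`; `E₁₈, E₃₆ = 1 + o(q¹³)` are
  `EulerRemainders.tendsto_eulerFn`);
* §2 `E₂(2τ), E₂(4τ), E₂(6τ), E₂(12τ), E₂(18τ), E₂(36τ)` to `o(q¹³)` (`E₂(q) = 1 − 24Σσ₁(n)qⁿ`);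
* (§3, the ten `η`-quotients `𝓔, y, A, B, C₁, …, C₆` as `q^a·∏E_δ^{r_δ}`, is the sequel `…EtaQuotientsSeventyTwo`.)

Pure `q`-series bookkeeping; nothing here proves C2, C3, Manin's conjecture or BSD. [cite: Ligozat1975, Ch. 3] [cite: Zagier2008, §2.3]
[cite: CremonaAlgorithms1997, Table 1 (72a1)]
-/

set_option autoImplicit false
-- lint-debt: the directory name repeats the summit name (sibling precedent `ManinLocalTwoThreeEulerRemaindersSixtyFour.lean`)
set_option linter.dupNamespace false

noncomputable section

open Complex Filter Topology Set Asymptotics Polynomial EisensteinSeries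
open UpperHalfPlane hiding I
open scoped Real Topology Manifold MatrixGroups
open Literature.NumberTheory.ModularForms
open Literature.NumberTheory.EllipticCurves Literature.NumberTheory.EllipticCurves.ModularForms

namespace Summit.BirchSwinnertonDyer.BirchSwinnertonDyer.Theorems.ManinLocalTwoThree.EulerRemaindersSeventyTwo

open QRemainder EulerRemainders EulerRemaindersTwenty EtaLogDerivativeForms

/-! ## §1 `E₂, E₄, E₆, E₁₂` to order `q¹³` -/

/-- The `q`-coefficients `n ≤ 13` of `E2`: `1, 0, −1, 0, −1, 0, 0, 0, 0, 0, 1, 0, 0, 0`. [folklore] -/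
theorem coeff_formalEulerScaled_two_le_thirteen (n : ℕ) (hn : n ≤ 13) :
    PowerSeries.coeff n (formalEulerScaled 2) = if n = 0 then 1 else if n = 2 then -1 else if n = 4 then -1 else if n = 10 then 1 else 0 := by
  have h := coeff_formalEulerPow_one_le_six
  interval_cases n <;> simp +decide [coeff_formalEulerScaled, h]

/-- **`E2 = 1 - q ^ 2 - q ^ 4 + q ^ 10 + o(q¹³)`.** [folklore] -/
theorem tendsto_eulerFn_two_thirteen :
    Tendsto (fun τ : ℍ ↦ (eulerFn 2 τ - (1 - X ^ 2 - X ^ 4 + X ^ 10 : ℂ[X]).eval (Function.Periodic.qParam 1 (τ : ℂ)))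
      / Function.Periodic.qParam 1 (τ : ℂ) ^ 13) atImInfty (𝓝 0) := by
  refine congr_poly ?_ (tendsto_of_hasSum (periodic_eulerFn 2) (mdifferentiable_eulerFn 2)
    (isBoundedAtImInfty_eulerFn (by norm_num)) (hasSum_eulerFn (by norm_num)) 13)
  have h := coeff_formalEulerScaled_two_le_thirteen
  simp only [Finset.sum_range_succ, Finset.sum_range_zero, h 0 (by norm_num), h 1 (by norm_num), h 2 (by norm_num), h 3 (by norm_num), h 4 (by norm_num), h 5 (by norm_num), h 6 (by norm_num), h 7 (by norm_num), h 8 (by norm_num), h 9 (by norm_num), h 10 (by norm_num), h 11 (by norm_num), h 12 (by norm_num), h 13 (by norm_num)]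
  norm_num
  ring

/-- The `q`-coefficients `n ≤ 13` of `E4`: `1` at `0`, `−1` at `4, 8`, else `0`. [folklore] -/
theorem coeff_formalEulerScaled_four_le_thirteen (n : ℕ) (hn : n ≤ 13) :
    PowerSeries.coeff n (formalEulerScaled 4) = if n = 0 then 1 else if n = 4 then -1 else if n = 8 then -1 else 0 := by
  have h := coeff_formalEulerPow_one_le_six
  interval_cases n <;> simp +decide [coeff_formalEulerScaled, h]

/-- **`E4 = 1 - q ^ 4 - q ^ 8 + o(q¹³)`.** [folklore] -/
theorem tendsto_eulerFn_four_thirteen :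
    Tendsto (fun τ : ℍ ↦ (eulerFn 4 τ - (1 - X ^ 4 - X ^ 8 : ℂ[X]).eval (Function.Periodic.qParam 1 (τ : ℂ)))
      / Function.Periodic.qParam 1 (τ : ℂ) ^ 13) atImInfty (𝓝 0) := by
  refine congr_poly ?_ (tendsto_of_hasSum (periodic_eulerFn 4) (mdifferentiable_eulerFn 4)
    (isBoundedAtImInfty_eulerFn (by norm_num)) (hasSum_eulerFn (by norm_num)) 13)
  have h := coeff_formalEulerScaled_four_le_thirteen
  simp only [Finset.sum_range_succ, Finset.sum_range_zero, h 0 (by norm_num), h 1 (by norm_num), h 2 (by norm_num), h 3 (by norm_num), h 4 (by norm_num), h 5 (by norm_num), h 6 (by norm_num), h 7 (by norm_num), h 8 (by norm_num), h 9 (by norm_num), h 10 (by norm_num), h 11 (by norm_num), h 12 (by norm_num), h 13 (by norm_num)]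
  norm_num
  ring

/-- The `q`-coefficients `n ≤ 13` of `E6`: `1` at `0`, `−1` at `6, 12`, else `0`. [folklore] -/
theorem coeff_formalEulerScaled_six_le_thirteen (n : ℕ) (hn : n ≤ 13) :
    PowerSeries.coeff n (formalEulerScaled 6) = if n = 0 then 1 else if n = 6 then -1 else if n = 12 then -1 else 0 := by
  have h := coeff_formalEulerPow_one_le_six
  interval_cases n <;> simp +decide [coeff_formalEulerScaled, h]

/-- **`E6 = 1 - q ^ 6 - q ^ 12 + o(q¹³)`.** [folklore] -/
theorem tendsto_eulerFn_six_thirteen :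
    Tendsto (fun τ : ℍ ↦ (eulerFn 6 τ - (1 - X ^ 6 - X ^ 12 : ℂ[X]).eval (Function.Periodic.qParam 1 (τ : ℂ)))
      / Function.Periodic.qParam 1 (τ : ℂ) ^ 13) atImInfty (𝓝 0) := by
  refine congr_poly ?_ (tendsto_of_hasSum (periodic_eulerFn 6) (mdifferentiable_eulerFn 6)
    (isBoundedAtImInfty_eulerFn (by norm_num)) (hasSum_eulerFn (by norm_num)) 13)
  have h := coeff_formalEulerScaled_six_le_thirteen
  simp only [Finset.sum_range_succ, Finset.sum_range_zero, h 0 (by norm_num), h 1 (by norm_num), h 2 (by norm_num), h 3 (by norm_num), h 4 (by norm_num), h 5 (by norm_num), h 6 (by norm_num), h 7 (by norm_num), h 8 (by norm_num), h 9 (by norm_num), h 10 (by norm_num), h 11 (by norm_num), h 12 (by norm_num), h 13 (by norm_num)]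
  norm_num
  ring

/-- The `q`-coefficients `n ≤ 13` of `E12`: `1` at `0`, `−1` at `12`, else `0`. [folklore] -/
theorem coeff_formalEulerScaled_twelve_le_thirteen (n : ℕ) (hn : n ≤ 13) :
    PowerSeries.coeff n (formalEulerScaled 12) = if n = 0 then 1 else if n = 12 then -1 else 0 := by
  have h := coeff_formalEulerPow_one_le_six
  interval_cases n <;> simp +decide [coeff_formalEulerScaled, h]

/-- **`E12 = 1 - q ^ 12 + o(q¹³)`.** [folklore] -/
theorem tendsto_eulerFn_twelve_thirteen :
    Tendsto (fun τ : ℍ ↦ (eulerFn 12 τ - (1 - X ^ 12 : ℂ[X]).eval (Function.Periodic.qParam 1 (τ : ℂ)))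
      / Function.Periodic.qParam 1 (τ : ℂ) ^ 13) atImInfty (𝓝 0) := by
  refine congr_poly ?_ (tendsto_of_hasSum (periodic_eulerFn 12) (mdifferentiable_eulerFn 12)
    (isBoundedAtImInfty_eulerFn (by norm_num)) (hasSum_eulerFn (by norm_num)) 13)
  have h := coeff_formalEulerScaled_twelve_le_thirteen
  simp only [Finset.sum_range_succ, Finset.sum_range_zero, h 0 (by norm_num), h 1 (by norm_num), h 2 (by norm_num), h 3 (by norm_num), h 4 (by norm_num), h 5 (by norm_num), h 6 (by norm_num), h 7 (by norm_num), h 8 (by norm_num), h 9 (by norm_num), h 10 (by norm_num), h 11 (by norm_num), h 12 (by norm_num), h 13 (by norm_num)]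
  norm_num
  ring

/-! ## §2 `E₂(δτ)` to order `q¹³`, `δ ∈ {2, 4, 6, 12, 18, 36}` -/

/-- `σ₁(1) = 1, σ₁(2) = 3, σ₁(3) = 4, σ₁(4) = 7, σ₁(5) = 6, σ₁(6) = 12`. [folklore] -/
theorem sigma_one_le_six :
    ArithmeticFunction.sigma 1 1 = 1 ∧ ArithmeticFunction.sigma 1 2 = 3 ∧ ArithmeticFunction.sigma 1 3 = 4 ∧
      ArithmeticFunction.sigma 1 4 = 7 ∧ ArithmeticFunction.sigma 1 5 = 6 ∧ ArithmeticFunction.sigma 1 6 = 12 := by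
  refine ⟨by decide, by decide, by decide, by decide, by decide, by decide⟩

/-- **`E₂(2τ) = 1 - 24 * q ^ 2 - 72 * q ^ 4 - 96 * q ^ 6 - 168 * q ^ 8 - 144 * q ^ 10 - 288 * q ^ 12 + o(q¹³)`** (`σ₁ = 1, 3, 4, 7, 6, 12` at `1, …, 6`). [cite: Zagier2008, §2.3] -/
theorem tendsto_E2_two_thirteen :
    Tendsto (fun τ : ℍ ↦ (E2 (sixMulPt 2 τ) - (1 - 24 * X ^ 2 - 72 * X ^ 4 - 96 * X ^ 6 - 168 * X ^ 8 - 144 * X ^ 10 - 288 * X ^ 12 : ℂ[X]).eval (Function.Periodic.qParam 1 (τ : ℂ)))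
      / Function.Periodic.qParam 1 (τ : ℂ) ^ 13) atImInfty (𝓝 0) := by
  refine congr_poly ?_ (tendsto_E2_sixMulPt (by norm_num : 0 < 2) 13)
  obtain ⟨s1, s2, s3, s4, s5, s6⟩ := sigma_one_le_six
  simp only [Finset.sum_range_succ, Finset.sum_range_zero, e2NatMulCoeff_eq _ _ (by norm_num : 0 < 2)]
  norm_num [s1, s2, s3, s4, s5, s6]
  simp only [map_ofNat]
  ring

/-- **`E₂(4τ) = 1 - 24 * q ^ 4 - 72 * q ^ 8 - 96 * q ^ 12 + o(q¹³)`** (`σ₁ = 1, 3, 4, 7, 6, 12` at `1, …, 6`). [cite: Zagier2008, §2.3] -/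
theorem tendsto_E2_four_thirteen :
    Tendsto (fun τ : ℍ ↦ (E2 (sixMulPt 4 τ) - (1 - 24 * X ^ 4 - 72 * X ^ 8 - 96 * X ^ 12 : ℂ[X]).eval (Function.Periodic.qParam 1 (τ : ℂ)))
      / Function.Periodic.qParam 1 (τ : ℂ) ^ 13) atImInfty (𝓝 0) := by
  refine congr_poly ?_ (tendsto_E2_sixMulPt (by norm_num : 0 < 4) 13)
  obtain ⟨s1, s2, s3, s4, s5, s6⟩ := sigma_one_le_six
  simp only [Finset.sum_range_succ, Finset.sum_range_zero, e2NatMulCoeff_eq _ _ (by norm_num : 0 < 4)]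
  norm_num [s1, s2, s3, s4, s5, s6]
  simp only [map_ofNat]
  ring

/-- **`E₂(6τ) = 1 - 24 * q ^ 6 - 72 * q ^ 12 + o(q¹³)`** (`σ₁ = 1, 3, 4, 7, 6, 12` at `1, …, 6`). [cite: Zagier2008, §2.3] -/
theorem tendsto_E2_six_thirteen :
    Tendsto (fun τ : ℍ ↦ (E2 (sixMulPt 6 τ) - (1 - 24 * X ^ 6 - 72 * X ^ 12 : ℂ[X]).eval (Function.Periodic.qParam 1 (τ : ℂ)))
      / Function.Periodic.qParam 1 (τ : ℂ) ^ 13) atImInfty (𝓝 0) := by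
  refine congr_poly ?_ (tendsto_E2_sixMulPt (by norm_num : 0 < 6) 13)
  obtain ⟨s1, s2, s3, s4, s5, s6⟩ := sigma_one_le_six
  simp only [Finset.sum_range_succ, Finset.sum_range_zero, e2NatMulCoeff_eq _ _ (by norm_num : 0 < 6)]
  norm_num [s1, s2, s3, s4, s5, s6]
  simp only [map_ofNat]
  ring

/-- **`E₂(12τ) = 1 - 24 * q ^ 12 + o(q¹³)`** (`σ₁ = 1, 3, 4, 7, 6, 12` at `1, …, 6`). [cite: Zagier2008, §2.3] -/
theorem tendsto_E2_twelve_thirteen :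
    Tendsto (fun τ : ℍ ↦ (E2 (sixMulPt 12 τ) - (1 - 24 * X ^ 12 : ℂ[X]).eval (Function.Periodic.qParam 1 (τ : ℂ)))
      / Function.Periodic.qParam 1 (τ : ℂ) ^ 13) atImInfty (𝓝 0) := by
  refine congr_poly ?_ (tendsto_E2_sixMulPt (by norm_num : 0 < 12) 13)
  obtain ⟨s1, s2, s3, s4, s5, s6⟩ := sigma_one_le_six
  simp only [Finset.sum_range_succ, Finset.sum_range_zero, e2NatMulCoeff_eq _ _ (by norm_num : 0 < 12)]
  norm_num [s1, s2, s3, s4, s5, s6]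
  simp only [map_ofNat]
  ring

/-- **`E₂(18τ) = 1 + o(q¹³)`** (`σ₁ = 1, 3, 4, 7, 6, 12` at `1, …, 6`). [cite: Zagier2008, §2.3] -/
theorem tendsto_E2_eighteen_thirteen :
    Tendsto (fun τ : ℍ ↦ (E2 (sixMulPt 18 τ) - (1 : ℂ[X]).eval (Function.Periodic.qParam 1 (τ : ℂ)))
      / Function.Periodic.qParam 1 (τ : ℂ) ^ 13) atImInfty (𝓝 0) := by
  refine congr_poly ?_ (tendsto_E2_sixMulPt (by norm_num : 0 < 18) 13)
  simp only [Finset.sum_range_succ, Finset.sum_range_zero, e2NatMulCoeff_eq _ _ (by norm_num : 0 < 18)]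
  norm_num

/-- **`E₂(36τ) = 1 + o(q¹³)`** (`σ₁ = 1, 3, 4, 7, 6, 12` at `1, …, 6`). [cite: Zagier2008, §2.3] -/
theorem tendsto_E2_thirtySix_thirteen :
    Tendsto (fun τ : ℍ ↦ (E2 (sixMulPt 36 τ) - (1 : ℂ[X]).eval (Function.Periodic.qParam 1 (τ : ℂ)))
      / Function.Periodic.qParam 1 (τ : ℂ) ^ 13) atImInfty (𝓝 0) := by
  refine congr_poly ?_ (tendsto_E2_sixMulPt (by norm_num : 0 < 36) 13)
  simp only [Finset.sum_range_succ, Finset.sum_range_zero, e2NatMulCoeff_eq _ _ (by norm_num : 0 < 36)]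
  norm_num

end Summit.BirchSwinnertonDyer.BirchSwinnertonDyer.Theorems.ManinLocalTwoThree.EulerRemaindersSeventyTwo

end
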